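import Mathlib.Tactic.Linarith
import Mathlib.Tactic.Positivity
import Mathlib.Tactic.Ring
import Mathlib.Tactic.LinearCombination
import HarnessLib

/-!
# `NoHeavyLowerTail` (crux stmt-CriticalPhenomena-4575), P3 lane: the arithmetic of Case II of the row `#dbl = 3` of `(L_3)`

Support file (seat `prim-l12-p3`, gen 26; `--supports stmt-CriticalPhenomena-4575`).  Paper proof `prim-l12-p3/ROW3-PROOF-g26.md` §5,
Case II (`k₀ = 1, 2, 3`).  Pure integer arithmetic: given the per-family data of the accounting (TRI families: `L ≥ τ(τ+2)` and the cap
`q + 1 ≤ T2 + b`; DEG families: the two ψ₁-facts `(2τ−4)(L − q) ≥ (2τ+(τ−1)γ)(τ−4)+τ(τ+1)` and `γ + γ' ≤ τ+1`), the restriction cube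
`κ_R ≥ 4 + #Qd`, the loops `L1 ≥ 3·T2`, and the charge data, the row inequality `2Γ + 2(τ+2)WC₂ + 2WC₁ ≤ 2(κ_R + ΣL + L1)` follows for
`τ ≥ 18` (`rowThree_arith_k1`), `τ ≥ 16` (`_k2`), `τ ≥ 14` (`_k3`).  The certificates (slack decompositions) are recorded in the proofs.
Nothing is asserted about the crux.
-/

namespace Summit.CriticalPhenomena.PercolationContinuityZ3.Theorems.SahiCTCForms

/-- **Case II, k₀ = 1** (families 1, 2 triangle-type, family 3 degree-type seeing `γ₁, γ₂`). [this work] -/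
theorem rowThree_arith_k1 {τ κR L₁ L₂ L₃ L1 q₁ q₂ q₃ γ₁ γ₂ γ₃ Γ2 T2 WC1 WC2 Qd b₁ b₂ b₃ : ℤ} (hτ : 18 ≤ τ)
    (hR : 4 + Qd ≤ κR) (hL1 : 3 * T2 ≤ L1) (hWC1 : WC1 ≤ q₁ + q₂ + q₃) (hWC2 : WC2 ≤ γ₁ + γ₂ + γ₃)
    (hΓ : Γ2 = τ ^ 2 + 7 * τ + 14) (hT2 : 2 * T2 = τ ^ 2 - τ) (hQd : b₁ + b₂ + b₃ ≤ Qd) (hb₃ : 0 ≤ b₃)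
    (hγ₃ : γ₃ ≤ τ)
    (htri₁ : τ * (τ + 2) ≤ L₁) (hcap₁ : q₁ + 1 ≤ T2 + b₁) (htri₂ : τ * (τ + 2) ≤ L₂) (hcap₂ : q₂ + 1 ≤ T2 + b₂)
    (hpsi₃ : (2 * τ + (τ - 1) * γ₁) * (τ - 4) + τ * (τ + 1) ≤ (2 * τ - 4) * (L₃ - q₃))
    (hpsi₃' : (2 * τ + (τ - 1) * γ₂) * (τ - 4) + τ * (τ + 1) ≤ (2 * τ - 4) * (L₃ - q₃)) (hpair₃ : γ₁ + γ₂ ≤ τ + 1) :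
    Γ2 + 2 * (τ + 2) * WC2 + 2 * WC1 ≤ 2 * (κR + (L₁ + L₂ + L₃) + L1) := by
  have hP : (0 : ℤ) < 2 * τ - 4 := by linarith
  refine le_of_mul_le_mul_left ?_ hP
  -- slack decomposition: E = (τ³ − 18τ² + 13τ + 28) + (3τ²+5τ−20)(τ+1−S) + (4τ²−16)(τ−γ₃) + (4τ−8)b₃ + nonneg multiples of the facts
  have s0 : (0 : ℤ) ≤ τ - 18 := by linarith
  have c0 : (0 : ℤ) ≤ (τ - 18) ^ 3 + 36 * (τ - 18) ^ 2 + 337 * (τ - 18) + 262 := by positivity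
  have c1 : (0 : ℤ) ≤ (3 * τ ^ 2 + 5 * τ - 20) * (τ + 1 - (γ₁ + γ₂)) := mul_nonneg (by nlinarith) (by linarith)
  have c2 : (0 : ℤ) ≤ (4 * τ ^ 2 - 16) * (τ - γ₃) := mul_nonneg (by nlinarith) (by linarith)
  have c3 : (0 : ℤ) ≤ (4 * τ - 8) * b₃ := mul_nonneg (by linarith) hb₃
  have p1 := mul_le_mul_of_nonneg_left hR hP.le
  have p2 := mul_le_mul_of_nonneg_left hL1 hP.le
  have p3 := mul_le_mul_of_nonneg_left hWC1 hP.le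
  have p4 : (2 * τ - 4) * ((τ + 2) * WC2) ≤ (2 * τ - 4) * ((τ + 2) * (γ₁ + γ₂ + γ₃)) :=
    mul_le_mul_of_nonneg_left (mul_le_mul_of_nonneg_left hWC2 (by linarith)) hP.le
  have p5 := mul_le_mul_of_nonneg_left htri₁ hP.le
  have p6 := mul_le_mul_of_nonneg_left htri₂ hP.le
  have p7 := mul_le_mul_of_nonneg_left hcap₁ hP.le
  have p8 := mul_le_mul_of_nonneg_left hcap₂ hP.le
  have p9 := mul_le_mul_of_nonneg_left hQd hP.le
  have p10 : (2 * τ - 4) * (2 * T2) = (2 * τ - 4) * (τ ^ 2 - τ) := by rw [hT2]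
  rw [hΓ]
  nlinarith [c0, c1, c2, c3, p1, p2, p3, p4, p5, p6, p7, p8, p9, p10, hpsi₃, hpsi₃']

/-- **Case II, k₀ = 2** (family 1 triangle-type seeing `γ₂, γ₃`; families 2 (`γ₁, γ₃`) and 3 (`γ₁, γ₂`) degree-type). [this work] -/
theorem rowThree_arith_k2 {τ κR L₁ L₂ L₃ L1 q₁ q₂ q₃ γ₁ γ₂ γ₃ Γ2 T2 WC1 WC2 Qd b₁ b₂ b₃ : ℤ} (hτ : 16 ≤ τ)
    (hR : 4 + Qd ≤ κR) (hL1 : 3 * T2 ≤ L1) (hWC1 : WC1 ≤ q₁ + q₂ + q₃) (hWC2 : WC2 ≤ γ₁ + γ₂ + γ₃)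
    (hΓ : Γ2 = τ ^ 2 + 7 * τ + 14) (hT2 : 2 * T2 = τ ^ 2 - τ) (hQd : b₁ + b₂ + b₃ ≤ Qd) (hb₂ : 0 ≤ b₂) (hb₃ : 0 ≤ b₃)
    (hγ₂ : γ₂ ≤ τ) (hγ₃ : γ₃ ≤ τ)
    (htri₁ : τ * (τ + 2) ≤ L₁) (hcap₁ : q₁ + 1 ≤ T2 + b₁)
    (hpsi₂ : (2 * τ + (τ - 1) * γ₃) * (τ - 4) + τ * (τ + 1) ≤ (2 * τ - 4) * (L₂ - q₂)) (hpair₂ : γ₁ + γ₃ ≤ τ + 1)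
    (hpsi₃ : (2 * τ + (τ - 1) * γ₂) * (τ - 4) + τ * (τ + 1) ≤ (2 * τ - 4) * (L₃ - q₃)) (hpair₃ : γ₁ + γ₂ ≤ τ + 1) :
    Γ2 + 2 * (τ + 2) * WC2 + 2 * WC1 ≤ 2 * (κR + (L₁ + L₂ + L₃) + L1) := by
  have hP : (0 : ℤ) < 2 * τ - 4 := by linarith
  refine le_of_mul_le_mul_left ?_ hP
  -- 2E = 2(2τ³ − 34τ² + 32τ + 32) + 2(10τ−16)(2τ−W) + (4τ²−16)(2τ+2−W−2γ₁) + 2(4τ−8)(b₂+b₃), W = γ₂+γ₃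
  have c0 : (0 : ℤ) ≤ 2 * (τ - 16) ^ 3 + 62 * (τ - 16) ^ 2 + 480 * (τ - 16) + 32 := by
    have s0 : (0 : ℤ) ≤ τ - 16 := by linarith
    positivity
  have c1 : (0 : ℤ) ≤ (10 * τ - 16) * (2 * τ - (γ₂ + γ₃)) := mul_nonneg (by linarith) (by linarith)
  have c2 : (0 : ℤ) ≤ (4 * τ ^ 2 - 16) * (2 * τ + 2 - (γ₂ + γ₃) - 2 * γ₁) := mul_nonneg (by nlinarith) (by linarith)
  have c3 : (0 : ℤ) ≤ (4 * τ - 8) * (b₂ + b₃) := mul_nonneg (by linarith) (by linarith)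
  have p1 := mul_le_mul_of_nonneg_left hR hP.le
  have p2 := mul_le_mul_of_nonneg_left hL1 hP.le
  have p3 := mul_le_mul_of_nonneg_left hWC1 hP.le
  have p4 : (2 * τ - 4) * ((τ + 2) * WC2) ≤ (2 * τ - 4) * ((τ + 2) * (γ₁ + γ₂ + γ₃)) :=
    mul_le_mul_of_nonneg_left (mul_le_mul_of_nonneg_left hWC2 (by linarith)) hP.le
  have p5 := mul_le_mul_of_nonneg_left htri₁ hP.le
  have p7 := mul_le_mul_of_nonneg_left hcap₁ hP.le
  have p9 := mul_le_mul_of_nonneg_left hQd hP.le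
  have p10 : (2 * τ - 4) * (2 * T2) = (2 * τ - 4) * (τ ^ 2 - τ) := by rw [hT2]
  rw [hΓ]
  nlinarith [c0, c1, c2, c3, p1, p2, p3, p4, p5, p7, p9, p10, hpsi₂, hpsi₃]

/-- **Case II, k₀ = 3** (all three families degree-type; pairwise intersections ≤ 1 give `γ₁+γ₂+γ₃ ≤ τ+3`; one ψ₁-fact per family,
chosen cyclically: family 1 with `γ₂`, family 2 with `γ₃`, family 3 with `γ₁`). [this work] -/
theorem rowThree_arith_k3 {τ κR L₁ L₂ L₃ L1 q₁ q₂ q₃ γ₁ γ₂ γ₃ Γ2 T2 WC1 WC2 Qd : ℤ} (hτ : 14 ≤ τ)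
    (hR : 4 + Qd ≤ κR) (hQd : 0 ≤ Qd) (hL1 : 3 * T2 ≤ L1) (hWC1 : WC1 ≤ q₁ + q₂ + q₃) (hWC2 : WC2 ≤ γ₁ + γ₂ + γ₃)
    (hΓ : Γ2 = τ ^ 2 + 7 * τ + 14) (hT2 : 2 * T2 = τ ^ 2 - τ)
    (hpsi₁ : (2 * τ + (τ - 1) * γ₂) * (τ - 4) + τ * (τ + 1) ≤ (2 * τ - 4) * (L₁ - q₁))
    (hpsi₂ : (2 * τ + (τ - 1) * γ₃) * (τ - 4) + τ * (τ + 1) ≤ (2 * τ - 4) * (L₂ - q₂))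
    (hpsi₃ : (2 * τ + (τ - 1) * γ₁) * (τ - 4) + τ * (τ + 1) ≤ (2 * τ - 4) * (L₃ - q₃))
    (hIE : γ₁ + γ₂ + γ₃ ≤ τ + 3) :
    Γ2 + 2 * (τ + 2) * WC2 + 2 * WC1 ≤ 2 * (κR + (L₁ + L₂ + L₃) + L1) := by
  have hP : (0 : ℤ) < 2 * τ - 4 := by linarith
  refine le_of_mul_le_mul_left ?_ hP
  -- E = (2τ³ − 26τ² − 20τ + 96) + (2τ²+10τ−24)(τ+3−σ)
  have c0 : (0 : ℤ) ≤ 2 * (τ - 14) ^ 3 + 58 * (τ - 14) ^ 2 + 428 * (τ - 14) + 208 := by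
    have s0 : (0 : ℤ) ≤ τ - 14 := by linarith
    positivity
  have c1 : (0 : ℤ) ≤ (2 * τ ^ 2 + 10 * τ - 24) * (τ + 3 - (γ₁ + γ₂ + γ₃)) := mul_nonneg (by nlinarith) (by linarith)
  have p1 := mul_le_mul_of_nonneg_left hR hP.le
  have p2 := mul_le_mul_of_nonneg_left hL1 hP.le
  have p3 := mul_le_mul_of_nonneg_left hWC1 hP.le
  have p4 : (2 * τ - 4) * ((τ + 2) * WC2) ≤ (2 * τ - 4) * ((τ + 2) * (γ₁ + γ₂ + γ₃)) :=
    mul_le_mul_of_nonneg_left (mul_le_mul_of_nonneg_left hWC2 (by linarith)) hP.le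
  have p9 := mul_le_mul_of_nonneg_left hQd hP.le
  have p10 : (2 * τ - 4) * (2 * T2) = (2 * τ - 4) * (τ ^ 2 - τ) := by rw [hT2]
  rw [hΓ]
  nlinarith [c0, c1, p1, p2, p3, p4, p9, p10, hpsi₁, hpsi₂, hpsi₃]

end Summit.CriticalPhenomena.PercolationContinuityZ3.Theorems.SahiCTCForms
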